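import Mathlib
import HarnessLib
import Literature.Combinatorics.Additive.KempermanStructureTheoremNecessity

/-!
# A Kemperman decomposition with a (non-degenerate) type (III) bottom pair has periodic sumset

[cite: Grynkiewicz2009, §2 (remarks after KST: «For type (III), the quasi-period may always be taken to be H(A + B)»); §6 Claim 5 («Since φ_H(A + B) is aperiodic, it follows that we cannot have type (III)»)] [tag: critical-pair] [tag: inverse-theorem]

Topic `Literature/Combinatorics/Additive`.  Cell `mm-stpp` (D-0046), seat `mm-stpp-lit` (gen 23); the
port of D. J. Grynkiewicz, *A step beyond Kemperman's structure theorem*, Mathematika **55** (2009)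
67–114 continued.  A one-line remark used in §6 Claim 5, case `l = 4` (print p. 25: «Since
`φ_H(A + B)` is aperiodic, it follows that we cannot have type (III)»), resting on §2 (print p. 4:
type (III) has `A₀ ⊆ a + H′`, `B₀ ⊆ b + H′`, `|A₀| + |B₀| = |H′| + 1` «and thus `A₀ + B₀ = a + b + H′`
by Proposition 2.1»; p. 5: «For type (III), the quasi-period may always be taken to be `H(A + B)`»):
if `A = A₁ ∪ A₀`, `B = B₁ ∪ B₀` is a Kemperman decomposition (tree: `IsKempermanDecompI L …`) whose
bottom pair `(A₀, B₀)` is of type (III) with `|A₀| + |B₀| ≥ 3` (the tree's `IsElementaryIII` also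
admits the degenerate `|A₀| = |B₀| = 1`, `H′ = 0`, which is type (I)), then `A + B` is periodic —
indeed `H′`-periodic: `A₀ + B₀ = a + b + H′` is a full `H′`-coset, this coset lies in one `L`-coset
(so `H′ ≤ L`), and the rest `(A₁ + B) ∪ (A₀ + B₁)` of `A + B` is `L`-periodic.

MAIN RESULT (0 definitions, 0 named facts; everything PROVED).
* `IsKempermanDecompI.isPeriodic_add_of_isElementaryIII`.

## References
* D. J. Grynkiewicz, *A step beyond Kemperman's structure theorem*, Mathematika 55 (2009) 67–114,
  doi:10.1112/S0025579300000966, §2 (pp. 4–5), §6 Claim 5 (p. 25) [cite: Grynkiewicz2009, §2; Thm 4.1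
  (proof, Claim 5)] — held `paper:doi-10-1112-s0025579300000966`, p0004–p0005, p0025 read 2026-08-29.
-/

namespace Literature.Combinatorics.Additive

open Finset
open scoped Pointwise

universe u

variable {G : Type u} [AddCommGroup G] [DecidableEq G]

namespace IsKempermanDecompI

/-- **Type (III) at the bottom ⟹ `A + B` periodic.**  For a Kemperman decomposition
`A = A₁ ∪ A₀`, `B = B₁ ∪ B₀` with quasi-period `L` whose elementary pair `(A₀, B₀)` is of type (III)
with `|A₀| + |B₀| ≥ 3` (subgroup `H′`, `|A₀| + |B₀| = |H′| + 1`): `A₀ + B₀ = a + b + H′` (Prop 2.1),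
`H′ ≤ L`, and `A + B = (A₁ + B) ∪ (A₀ + B₁) ∪ (A₀ + B₀)` is `H′`-periodic.
[cite: Grynkiewicz2009, §2 («and thus A + B = a + b + H by Proposition 2.1»; «for type (III), the
quasi-period may always be taken to be H(A + B)»); §6 Claim 5 («we cannot have type (III)»)] -/
theorem isPeriodic_add_of_isElementaryIII {L : AddSubgroup G} {A B A₁ A₀ B₁ B₀ : Finset G}
    (h : IsKempermanDecompI L A B A₁ A₀ B₁ B₀) (hIII : IsElementaryIII A₀ B₀)
    (h3 : 3 ≤ #A₀ + #B₀) : IsPeriodic (A + B) := by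
  classical
  obtain ⟨H, a, b, ha, hb, hAH, hBH, hcard, -⟩ := hIII
  have hcardH : Nat.card H + 1 = #A₀ + #B₀ := hcard.symm
  haveI : Finite H := Nat.finite_of_card_ne_zero (by omega)
  have hfin : (H : Set G).Finite := Set.toFinite _
  set Hf : Finset G := hfin.toFinset with hHfdef
  have hHf : ∀ g, g ∈ Hf ↔ g ∈ H := fun g => by
    rw [hHfdef, Set.Finite.mem_toFinset]; rfl
  have hcardHf : #Hf = Nat.card H := by
    rw [hHfdef, ← Set.ncard_eq_toFinset_card (H : Set G) hfin]
    rfl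
  -- `A₀ ⊆ a + H`, `B₀ ⊆ b + H`
  have hA : A₀ ⊆ a +ᵥ Hf := fun x hx =>
    mem_vadd_finset.2 ⟨x - a, (hHf _).2 (hAH x hx), by rw [vadd_eq_add]; abel⟩
  have hB : B₀ ⊆ b +ᵥ Hf := fun y hy =>
    mem_vadd_finset.2 ⟨y - b, (hHf _).2 (hBH y hy), by rw [vadd_eq_add]; abel⟩
  -- Proposition 2.1: `A₀ + B₀ = a + b + H`
  have hcos : A₀ + B₀ = (a + b) +ᵥ Hf := by
    refine Subset.antisymm (fun z hz => ?_)
      (Grynkiewicz2009.vadd_subset_add_of_card_lt hHf hA hB (by rw [hcardHf]; omega))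
    obtain ⟨x, hx, y, hy, rfl⟩ := mem_add.1 hz
    refine mem_vadd_finset.2 ⟨(x - a) + (y - b), (hHf _).2 (H.add_mem (hAH x hx) (hBH y hy)), ?_⟩
    rw [vadd_eq_add]; abel
  -- `H ≤ L`
  have hHL : H ≤ L := by
    intro g hg
    have hmem : a + b + g ∈ A₀ + B₀ := by
      rw [hcos]; exact mem_vadd_finset.2 ⟨g, (hHf g).2 hg, rfl⟩
    obtain ⟨x, hx, y, hy, hxy⟩ := mem_add.1 hmem
    have := L.add_mem (h.decomp_left.sub_mem x hx a ha) (h.decomp_right.sub_mem y hy b hb)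
    rw [show x - a + (y - b) = x + y - (a + b) by abel, hxy, show a + b + g - (a + b) = g by abel]
      at this
    exact this
  -- `H ≠ 0`
  have hHne : H ≠ ⊥ := by
    intro hbot
    have : Nat.card H = 1 := by rw [hbot]; exact AddSubgroup.card_bot
    omega
  -- `A + B` is `H`-periodic
  have hHfper : IsPeriodicWith H Hf := fun g hg => vadd_finset_eq_of_forall_mem_iff hHf hg
  have hcosper : IsPeriodicWith H (A₀ + B₀) := by
    intro g hg
    rw [hcos, vadd_vadd, add_comm g, ← vadd_vadd, hHfper g hg]
  refine ⟨H, hHne, ?_⟩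
  rw [h.add_eq]
  exact ((isPeriodicWith_part h).mono hHL).union hcosper

end IsKempermanDecompI

end Literature.Combinatorics.Additive
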